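import Summits.ABC.ABC.Theses.BelyiSqueeze
import Literature.NumberTheory.DiophantineGeometry.BelyiWitnessExtremal
import Literature.NumberTheory.DiophantineGeometry.BelyiWitnessChart

/-!
# Refutation of `BelyiSqueeze.DegBelyiLower` (stmt-ABC-1205)

The crux claims `c ≤ C_ε · n^{1+ε}` whenever the abc triple `(a, b, c)` admits a Belyi map of degree
`n` through `{0, 1, ∞, a/c}`.  It is false: for odd `d = 2m + 1 ≥ 3` the map
`φ_m(t) = (−1)^m d^d · t^{m+1} (t − 1)^m / (d² t − 1)^m` of degree `d` over `ℚ` is Belyi (critical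
points `0`, `∞` of order `m` and `t = 1/d`, a TRIPLE zero of `φ_m − 1`) with rational special points
`0, 1, ∞, 1/d², 1/d`; `{0, 1, ∞, 1/d²}` has cross-ratio `1/d²`, so the abc triple `(1, d² − 1, d²)`
has a Belyi witness of degree `d = √c` (`m = 1`: the `T₃`-dessin of `(1,8,9)`; `m = 2`: `(1,24,25)`
in degree `5`), and `ε = 1/2` gives `d² ≤ C d^{3/2}` for all odd `d`, absurd.  (Mechanism:
`K t^a (t−1)^b/(t−v)^e` is Belyi with a triple point iff `a·b·e·(a+b−e)` is a square.)  Lean: the pair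
in the chart centred at the triple point is `p = (X+1)^{k+3}(M−X)^{k+2}`, `q = (dX+M)^{k+2}`
(`M = 2k+4`, `d = 2k+5`); `X³ ∣ p − q` = three vanishing Taylor coefficients; `#`special points
`= d + 1` is Mason–Stothers (tree: `succ_max_natDegree_le_card_roots`) plus the triple point; the
reverse chart change `exists_crossRatio_chart` (cf. the tree's `BelyiWitness.toInftyChart`) reaches
the route's normal form.  Refuter seat rreview-route-ABC-BelyiSqueeze-r-ee9464b7, 2026-08-15.
-/

namespace Summit.ABC.ABC.Theorems

open Polynomial
open Literature.NumberTheory.DiophantineGeometry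
open Literature.NumberTheory.DiophantineGeometry.BelyiWitness

/-- **Reverse chart change.** Coprime `p, q` with `max (deg p) (deg q) = n`, a degree drop among
`p, q, p − q` (`∞` special), `n + 1` affine special points, three of them `y, z, w` distinct, give a
witness in the normal form of route ABC/BelyiSqueeze with cross-ratio `(y − z)/(w − z) = CR(∞,y;z,w)`:
substitute `u ↦ u⁻¹ + t₀` for a non-special `t₀` (translate, then reflect). [folklore] -/
private theorem BelyiSqueeze.exists_crossRatio_chart {n : ℕ} {p q : ℂ[X]} {y z w : ℂ}
    (hcop : IsCoprime p q) (hmax : max p.natDegree q.natDegree = n)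
    (hdrop : p.natDegree < n ∨ q.natDegree < n ∨ (p - q).natDegree < n)
    (hcard : (p * q * (p - q)).roots.toFinset.card = n + 1)
    (hyz : y ≠ z) (hyw : y ≠ w) (hzw : z ≠ w)
    (hy : (p * q * (p - q)).eval y = 0) (hz : (p * q * (p - q)).eval z = 0)
    (hw : (p * q * (p - q)).eval w = 0) :
    ∃ (P Q : ℂ[X]) (x' y' z' w' : ℂ), IsCoprime P Q ∧ P.natDegree = n ∧ Q.natDegree = n ∧
      (P - Q).natDegree = n ∧ (P * Q * (P - Q)).roots.toFinset.card = n + 2 ∧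
      ({x', y', z', w'} : Finset ℂ).card = 4 ∧
      {x', y', z', w'} ⊆ (P * Q * (P - Q)).roots.toFinset ∧
      (w' - x') * (y' - z') = (y - z) / (w - z) * ((w' - z') * (y' - x')) := by
  classical
  obtain ⟨R, hR⟩ : ∃ R, R = p * q * (p - q) := ⟨_, rfl⟩
  rw [← hR] at hcard hy hz hw
  have hR0 : R ≠ 0 := by
    intro h; rw [h, roots_zero, Multiset.toFinset_zero, Finset.card_empty] at hcard; omega
  have hp0 : p ≠ 0 := fun h => hR0 (by rw [hR, h, zero_mul, zero_mul])
  have hq0 : q ≠ 0 := fun h => hR0 (by rw [hR, h, mul_zero, zero_mul])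
  have hn : 0 < n := by rcases hdrop with h | h | h <;> exact Nat.lt_of_le_of_lt (Nat.zero_le _) h
  have hp : p.natDegree ≤ n := hmax ▸ le_max_left _ _
  have hq : q.natDegree ≤ n := hmax ▸ le_max_right _ _
  have hpq : (p - q).natDegree ≤ n := (natDegree_sub_le _ _).trans (max_le hp hq)
  obtain ⟨t₀, ht₀⟩ : ∃ t₀ : ℂ, t₀ ∉ R.roots.toFinset := Infinite.exists_notMem_finset _
  have hRt : R.eval t₀ ≠ 0 := fun h => ht₀ (mem_roots_toFinset.mpr ⟨hR0, h⟩)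
  have hpt : p.eval t₀ ≠ 0 := fun h => hRt (by rw [hR, eval_mul, eval_mul, h, zero_mul, zero_mul])
  have hqt : q.eval t₀ ≠ 0 := fun h => hRt (by rw [hR, eval_mul, eval_mul, h, mul_zero, zero_mul])
  have hpqt : (p - q).eval t₀ ≠ 0 := fun h => hRt (by rw [hR, eval_mul, h, mul_zero])
  obtain ⟨P₁, hP₁⟩ : ∃ P₁, P₁ = taylor t₀ p := ⟨_, rfl⟩
  obtain ⟨Q₁, hQ₁⟩ : ∃ Q₁, Q₁ = taylor t₀ q := ⟨_, rfl⟩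
  have hPQ₁ : P₁ - Q₁ = taylor t₀ (p - q) := by rw [hP₁, hQ₁, map_sub]
  have hR₁ : P₁ * Q₁ * (P₁ - Q₁) = taylor t₀ R := by rw [hPQ₁, hP₁, hQ₁, hR, taylor_mul, taylor_mul]
  have hP₁deg : P₁.natDegree = p.natDegree := by rw [hP₁, natDegree_taylor]
  have hQ₁deg : Q₁.natDegree = q.natDegree := by rw [hQ₁, natDegree_taylor]
  have hPQ₁deg : (P₁ - Q₁).natDegree = (p - q).natDegree := by rw [hPQ₁, natDegree_taylor]
  have hcop₁ : IsCoprime P₁ Q₁ := by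
    rw [hP₁, hQ₁]; simpa using hcop.map (taylorAlgHom t₀).toRingHom
  have hev₁ : ∀ u, (P₁ * Q₁ * (P₁ - Q₁)).eval u = R.eval (u + t₀) := fun u => by
    rw [hR₁, taylor_eval]
  have hP₁c : P₁.coeff 0 = p.eval t₀ := by rw [hP₁, taylor_coeff_zero]
  have hQ₁c : Q₁.coeff 0 = q.eval t₀ := by rw [hQ₁, taylor_coeff_zero]
  have hPQ₁c : (P₁ - Q₁).coeff 0 = (p - q).eval t₀ := by rw [hPQ₁, taylor_coeff_zero]
  obtain ⟨P, hP⟩ : ∃ P, P = reflect n P₁ := ⟨_, rfl⟩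
  obtain ⟨Q, hQ⟩ : ∃ Q, Q = reflect n Q₁ := ⟨_, rfl⟩
  have hPQ : P - Q = reflect n (P₁ - Q₁) := by rw [hP, hQ, reflect_sub]
  have hPn : P.natDegree = n := hP ▸ natDegree_reflect_eq (hP₁deg.le.trans hp) (by rwa [hP₁c])
  have hQn : Q.natDegree = n := hQ ▸ natDegree_reflect_eq (hQ₁deg.le.trans hq) (by rwa [hQ₁c])
  have hPQn : (P - Q).natDegree = n :=
    hPQ ▸ natDegree_reflect_eq (hPQ₁deg.le.trans hpq) (by rwa [hPQ₁c])
  have hP0' : P ≠ 0 := fun h => by rw [h, natDegree_zero] at hPn; omega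
  have hQ0' : Q ≠ 0 := fun h => by rw [h, natDegree_zero] at hQn; omega
  have hPQ0' : P - Q ≠ 0 := fun h => by rw [h, natDegree_zero] at hPQn; omega
  have hR'0 : P * Q * (P - Q) ≠ 0 := mul_ne_zero (mul_ne_zero hP0' hQ0') hPQ0'
  have hev : ∀ u, u ≠ 0 → ((P * Q * (P - Q)).eval u = 0 ↔ R.eval (u⁻¹ + t₀) = 0) := by
    intro u hu
    rw [eval_mul, eval_mul, mul_eq_zero, mul_eq_zero, hPQ, hP, hQ,
      reflect_eval_eq_zero_iff (hP₁deg.le.trans hp) hu,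
      reflect_eval_eq_zero_iff (hQ₁deg.le.trans hq) hu,
      reflect_eval_eq_zero_iff (hPQ₁deg.le.trans hpq) hu, ← hev₁, eval_mul, eval_mul,
      mul_eq_zero, mul_eq_zero]
  have hev0 : (P * Q * (P - Q)).eval 0 = 0 := by   -- `0 = ∞'` is special (degree drop)
    rw [eval_mul, eval_mul, hPQ, hP, hQ, eval_zero_reflect, eval_zero_reflect, eval_zero_reflect]
    rcases hdrop with h | h | h
    · have h' : P₁.coeff n = 0 := coeff_eq_zero_of_natDegree_lt (by rw [hP₁deg]; exact h)
      rw [h', zero_mul, zero_mul]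
    · have h' : Q₁.coeff n = 0 := coeff_eq_zero_of_natDegree_lt (by rw [hQ₁deg]; exact h)
      rw [h', mul_zero, zero_mul]
    · have h' : (P₁ - Q₁).coeff n = 0 := coeff_eq_zero_of_natDegree_lt (by rw [hPQ₁deg]; exact h)
      rw [h', mul_zero]
  have hroots : (P * Q * (P - Q)).roots.toFinset =
      insert 0 (R.roots.toFinset.image (fun u => (u - t₀)⁻¹)) := by
    ext u
    rw [mem_roots_toFinset, Finset.mem_insert, Finset.mem_image]
    constructor
    · rintro ⟨-, hu⟩
      by_cases hu0 : u = 0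
      · exact Or.inl hu0
      · exact Or.inr ⟨u⁻¹ + t₀, mem_roots_toFinset.mpr ⟨hR0, (hev u hu0).mp hu⟩, by simp⟩
    · rintro (rfl | ⟨v, hv, rfl⟩)
      · exact ⟨hR'0, hev0⟩
      · obtain ⟨-, hvR⟩ := mem_roots_toFinset.mp hv
        have hvt : v - t₀ ≠ 0 := by
          intro h0; rw [sub_eq_zero] at h0; rw [h0] at hvR; exact hRt hvR
        refine ⟨hR'0, (hev _ (inv_ne_zero hvt)).mpr ?_⟩
        rw [inv_inv, sub_add_cancel]; exact hvR
  have hinj : Set.InjOn (fun u : ℂ => (u - t₀)⁻¹) ↑(R.roots.toFinset) := by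
    intro u _ v _ huv
    exact sub_left_inj.mp (inv_inj.mp huv)
  have h0notin : (0 : ℂ) ∉ R.roots.toFinset.image (fun u => (u - t₀)⁻¹) := by
    rw [Finset.mem_image]
    rintro ⟨v, hv, hv0⟩
    have h1 : v - t₀ = 0 := inv_eq_zero.mp hv0
    rw [sub_eq_zero] at h1; rw [h1] at hv; exact hRt (mem_roots_toFinset.mp hv).2
  have hcard' : (P * Q * (P - Q)).roots.toFinset.card = n + 2 := by
    rw [hroots, Finset.card_insert_of_notMem h0notin, Finset.card_image_of_injOn hinj, hcard]
  have hcop' : IsCoprime P Q := by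
    rw [Polynomial.isCoprime_iff_aeval_ne_zero_of_isAlgClosed ℂ ℂ]
    intro a
    simp only [coe_aeval_eq_eval]
    by_cases ha : a = 0
    · subst ha
      rw [hP, hQ, eval_zero_reflect, eval_zero_reflect]
      have hP₁0 : P₁ ≠ 0 := by rw [hP₁, Ne, taylor_eq_zero]; exact hp0
      have hQ₁0 : Q₁ ≠ 0 := by rw [hQ₁, Ne, taylor_eq_zero]; exact hq0
      rcases max_choice p.natDegree q.natDegree with hm | hm
      · left; have hl := leadingCoeff_ne_zero.mpr hP₁0
        rwa [leadingCoeff, hP₁deg, hm.symm.trans hmax] at hl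
      · right; have hl := leadingCoeff_ne_zero.mpr hQ₁0
        rwa [leadingCoeff, hQ₁deg, hm.symm.trans hmax] at hl
    · have h := (Polynomial.isCoprime_iff_aeval_ne_zero_of_isAlgClosed ℂ ℂ P₁ Q₁).mp hcop₁ a⁻¹
      simp only [coe_aeval_eq_eval] at h
      rcases h with h | h
      · left; rwa [Ne, hP, reflect_eval_eq_zero_iff (hP₁deg.le.trans hp) ha]
      · right; rwa [Ne, hQ, reflect_eval_eq_zero_iff (hQ₁deg.le.trans hq) ha]
  have hyt : y - t₀ ≠ 0 := fun h => by rw [sub_eq_zero] at h; rw [h] at hy; exact hRt hy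
  have hzt : z - t₀ ≠ 0 := fun h => by rw [sub_eq_zero] at h; rw [h] at hz; exact hRt hz
  have hwt : w - t₀ ≠ 0 := fun h => by rw [sub_eq_zero] at h; rw [h] at hw; exact hRt hw
  refine ⟨P, Q, 0, (y - t₀)⁻¹, (z - t₀)⁻¹, (w - t₀)⁻¹, hcop', hPn, hQn, hPQn, hcard', ?_, ?_, ?_⟩
  · have h0 : (0 : ℂ) ∉ ({(y - t₀)⁻¹, (z - t₀)⁻¹, (w - t₀)⁻¹} : Finset ℂ) := by
      simp only [Finset.mem_insert, Finset.mem_singleton, not_or]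
      exact ⟨(inv_ne_zero hyt).symm, (inv_ne_zero hzt).symm, (inv_ne_zero hwt).symm⟩
    have h3 : ({(y - t₀)⁻¹, (z - t₀)⁻¹, (w - t₀)⁻¹} : Finset ℂ).card = 3 := by
      rw [Finset.card_eq_three]
      exact ⟨_, _, _, fun h => hyz (sub_left_inj.mp (inv_inj.mp h)),
        fun h => hyw (sub_left_inj.mp (inv_inj.mp h)),
        fun h => hzw (sub_left_inj.mp (inv_inj.mp h)), rfl⟩
    rw [Finset.card_insert_of_notMem h0, h3]
  · intro u hu
    rw [hroots]
    simp only [Finset.mem_insert, Finset.mem_singleton] at hu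
    rcases hu with rfl | rfl | rfl | rfl
    · exact Finset.mem_insert_self _ _
    · exact Finset.mem_insert_of_mem (Finset.mem_image.mpr ⟨y, mem_roots_toFinset.mpr ⟨hR0, hy⟩, rfl⟩)
    · exact Finset.mem_insert_of_mem (Finset.mem_image.mpr ⟨z, mem_roots_toFinset.mpr ⟨hR0, hz⟩, rfl⟩)
    · exact Finset.mem_insert_of_mem (Finset.mem_image.mpr ⟨w, mem_roots_toFinset.mpr ⟨hR0, hw⟩, rfl⟩)
  · have hwz : w - z ≠ 0 := sub_ne_zero.mpr (Ne.symm hzw)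
    rw [sub_zero, sub_zero, inv_sub_inv hyt hzt, inv_sub_inv hwt hzt]
    field_simp
    ring

/-- **The square family.** For every `k`, the abc triple `(1, d² − 1, d²)`, `d = 2k + 5`, has a Belyi
witness of degree `d` in the normal form of route ABC/BelyiSqueeze (cross-ratio `1/d²`): the pair
`p = (X+1)^{k+3}(M−X)^{k+2}`, `q = (dX+M)^{k+2}` (`M = 2k+4`) in the chart centred at the triple point,
with marked special points `−M/d, −1, M` (`t = 1/d², 0, 1`) and `∞`. [folklore] -/
private theorem BelyiSqueeze.square_witness (k : ℕ) :
    ∃ (P Q : ℂ[X]) (x y z w : ℂ), IsCoprime P Q ∧ P.natDegree = 2 * k + 5 ∧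
      Q.natDegree = 2 * k + 5 ∧ (P - Q).natDegree = 2 * k + 5 ∧
      (P * Q * (P - Q)).roots.toFinset.card = 2 * k + 5 + 2 ∧
      ({x, y, z, w} : Finset ℂ).card = 4 ∧ {x, y, z, w} ⊆ (P * Q * (P - Q)).roots.toFinset ∧
      (w - x) * (y - z) = ((1 : ℕ) : ℂ) / (((2 * k + 5) ^ 2 : ℕ) : ℂ) * ((w - z) * (y - x)) := by
  obtain ⟨pF, hpF⟩ : ∃ pF : ℂ[X],
      pF = (X + C (1 : ℂ)) ^ (k + 3) * (C (2 * (k : ℂ) + 4) - X) ^ (k + 2) := ⟨_, rfl⟩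
  obtain ⟨qF, hqF⟩ : ∃ qF : ℂ[X],
      qF = (C (2 * (k : ℂ) + 5) * X + C (2 * (k : ℂ) + 4)) ^ (k + 2) := ⟨_, rfl⟩
  have hd : (2 * (k : ℂ) + 5) ≠ 0 := by exact_mod_cast (show (2 * k + 5 : ℕ) ≠ 0 by omega)
  -- degrees
  have hdegp : pF.natDegree = 2 * k + 5 := by
    have h2 : (C (2 * (k : ℂ) + 4) - X).natDegree = 1 := by
      rw [show C (2 * (k : ℂ) + 4) - X = -(X - C (2 * (k : ℂ) + 4)) by ring, natDegree_neg,
        natDegree_X_sub_C]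
    have h2' : (C (2 * (k : ℂ) + 4) - X) ^ (k + 2) ≠ 0 :=
      pow_ne_zero _ (ne_zero_of_natDegree_gt (n := 0) (by rw [h2]; omega))
    rw [hpF, natDegree_mul (pow_ne_zero _ (X_add_C_ne_zero 1)) h2', natDegree_pow, natDegree_pow,
      natDegree_X_add_C, h2]
    ring
  have hdegq : qF.natDegree = k + 2 := by rw [hqF, natDegree_pow, natDegree_linear hd, mul_one]
  have hdegsub : (pF - qF).natDegree = 2 * k + 5 := by
    rw [natDegree_sub_eq_left_of_natDegree_lt] <;> rw [hdegp]
    rw [hdegq]; omega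
  have hp0 : pF ≠ 0 := ne_zero_of_natDegree_gt (n := 0) (by rw [hdegp]; omega)
  have hq0 : qF ≠ 0 := ne_zero_of_natDegree_gt (n := 0) (by rw [hdegq]; omega)
  have hpq0 : pF - qF ≠ 0 := ne_zero_of_natDegree_gt (n := 0) (by rw [hdegsub]; omega)
  -- the zeros of `p` are `-1, M`; coprimality
  have hrootp : ∀ {a : ℂ}, pF.eval a = 0 → a = -1 ∨ a = 2 * (k : ℂ) + 4 := by
    intro a ha
    rw [hpF] at ha
    simp only [eval_mul, eval_pow, eval_add, eval_sub, eval_X, eval_C] at ha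
    rcases mul_eq_zero.mp ha with h | h
    · left; linear_combination (pow_eq_zero_iff (by omega)).mp h
    · right; linear_combination -(pow_eq_zero_iff (by omega)).mp h
  have hcop : IsCoprime pF qF := by
    rw [Polynomial.isCoprime_iff_aeval_ne_zero_of_isAlgClosed ℂ ℂ]
    intro a
    simp only [coe_aeval_eq_eval]
    by_cases ha : pF.eval a = 0
    · right
      rw [hqF]
      simp only [eval_pow, eval_add, eval_mul, eval_C, eval_X]
      rcases hrootp ha with h | h <;> rw [h]
      · rw [show (2 * (k : ℂ) + 5) * (-1) + (2 * (k : ℂ) + 4) = -1 by ring]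
        exact pow_ne_zero _ (by norm_num)
      · refine pow_ne_zero _ ?_
        rw [show (2 * (k : ℂ) + 5) * (2 * (k : ℂ) + 4) + (2 * (k : ℂ) + 4) =
            (((2 * k + 5) * (2 * k + 4) + (2 * k + 4) : ℕ) : ℂ) by push_cast; ring]
        exact_mod_cast (show ((2 * k + 5) * (2 * k + 4) + (2 * k + 4) : ℕ) ≠ 0 by positivity)
    · left; exact ha
  -- `0` is a triple point: `X³ ∣ p − q` (three vanishing Taylor coefficients)
  have e1 : k + 3 - 1 = k + 2 := (by omega); have e2 : k + 2 - 1 = k + 1 := (by omega)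
  have e3 : k + 1 - 1 = k := by omega
  have hc0 : ((0 : ℕ) : ℂ) + 1 ≠ 0 := by norm_num
  have hc1 : ((0 + 1 : ℕ) : ℂ) + 1 ≠ 0 := by norm_num
  have h0 : (pF - qF).coeff 0 = 0 := by
    rw [coeff_zero_eq_eval_zero, hpF, hqF]
    simp only [eval_sub, eval_mul, eval_pow, eval_add, eval_X, eval_C]
    ring
  have h1 : (pF - qF).coeff 1 = 0 := by
    have h : (derivative (pF - qF)).eval 0 = 0 := by
      rw [hpF, hqF]
      simp only [derivative_sub, derivative_mul, derivative_pow, derivative_add, derivative_X,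
        derivative_C, e1, e2, add_zero, zero_add, mul_one, zero_mul, zero_sub]
      simp only [eval_sub, eval_mul, eval_pow, eval_add, eval_X, eval_C, eval_neg, eval_one]
      push_cast
      ring
    rw [← coeff_zero_eq_eval_zero, coeff_derivative] at h
    exact (mul_eq_zero.mp h).resolve_right hc0
  have h2 : (pF - qF).coeff 2 = 0 := by
    have h : (derivative (derivative (pF - qF))).eval 0 = 0 := by
      rw [hpF, hqF]
      simp only [derivative_sub, derivative_mul, derivative_pow, derivative_add, derivative_X,
        derivative_C, derivative_neg, derivative_one, neg_zero, e1, e2, e3, add_zero, zero_add,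
        mul_one, zero_mul, mul_zero, zero_sub]
      simp only [eval_sub, eval_mul, eval_pow, eval_add, eval_X, eval_C, eval_neg, eval_one]
      push_cast
      ring
    rw [← coeff_zero_eq_eval_zero, coeff_derivative, coeff_derivative] at h
    exact (mul_eq_zero.mp ((mul_eq_zero.mp h).resolve_right hc0)).resolve_right hc1
  have hdvd : X ^ 3 ∣ (pF - qF) := by
    rw [X_pow_dvd_iff]
    intro j hj
    interval_cases j
    · exact h0
    · exact h1
    · exact h2
  -- at most `d + 1 = 2k + 6` distinct zeros of `p q (p - q)`
  have hcardle : (pF * qF * (pF - qF)).roots.toFinset.card ≤ 2 * k + 6 := by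
    have hA : pF.roots.toFinset.card ≤ 2 := by
      refine (Finset.card_le_card (t := {(-1 : ℂ), 2 * (k : ℂ) + 4}) ?_).trans Finset.card_le_two
      intro a ha
      simp only [Finset.mem_insert, Finset.mem_singleton]
      exact hrootp (mem_roots_toFinset.mp ha).2
    have hB : qF.roots.toFinset.card ≤ 1 := by
      refine (Finset.card_le_card (t := {-(2 * (k : ℂ) + 4) / (2 * (k : ℂ) + 5)}) ?_).trans
        (Finset.card_singleton _).le
      intro a ha
      have ha' := (mem_roots_toFinset.mp ha).2
      rw [hqF] at ha'
      simp only [eval_pow, eval_add, eval_mul, eval_X, eval_C] at ha'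
      rw [Finset.mem_singleton, eq_div_iff hd]
      linear_combination (pow_eq_zero_iff (by omega)).mp ha'
    have hC : (pF - qF).roots.toFinset.card ≤ 2 * k + 3 := by
      obtain ⟨S, hS⟩ := hdvd
      have hS0 : S ≠ 0 := fun h => hpq0 (by rw [hS, h, mul_zero])
      have hX3 : (X : ℂ[X]) ^ 3 ≠ 0 := pow_ne_zero _ X_ne_zero
      have hSdeg : S.natDegree = 2 * k + 2 := by
        have := congrArg natDegree hS
        rw [hdegsub, natDegree_mul hX3 hS0, natDegree_X_pow] at this
        omega
      rw [hS, roots_mul (mul_ne_zero hX3 hS0), Multiset.toFinset_add, roots_pow, roots_X,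
        Multiset.toFinset_nsmul _ _ (by norm_num), Multiset.toFinset_singleton]
      refine (Finset.card_union_le _ _).trans ?_
      rw [Finset.card_singleton]
      have := (Multiset.toFinset_card_le S.roots).trans ((card_roots' S).trans hSdeg.le)
      omega
    rw [roots_mul (mul_ne_zero (mul_ne_zero hp0 hq0) hpq0), roots_mul (mul_ne_zero hp0 hq0),
      Multiset.toFinset_add, Multiset.toFinset_add]
    refine (Finset.card_union_le _ _).trans ?_
    refine (Nat.add_le_add_right (Finset.card_union_le _ _) _).trans ?_
    have := Nat.add_le_add (Nat.add_le_add hA hB) hC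
    omega
  have hmax : max pF.natDegree qF.natDegree = 2 * k + 5 := by
    rw [hdegp, hdegq]; exact max_eq_left (by omega)
  have hdrop : pF.natDegree < 2 * k + 5 ∨ qF.natDegree < 2 * k + 5 ∨
      (pF - qF).natDegree < 2 * k + 5 := Or.inr (Or.inl (by rw [hdegq]; omega))
  have hcard : (pF * qF * (pF - qF)).roots.toFinset.card = 2 * k + 5 + 1 :=
    le_antisymm hcardle (succ_max_natDegree_le_card_roots hcop hmax (by omega))
  -- the marked special points `y = -M/d` (`t = 1/d²`), `z = -1` (`t = 0`), `w = M` (`t = 1`)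
  have hy : (pF * qF * (pF - qF)).eval (-(2 * (k : ℂ) + 4) / (2 * (k : ℂ) + 5)) = 0 := by
    have : qF.eval (-(2 * (k : ℂ) + 4) / (2 * (k : ℂ) + 5)) = 0 := by
      rw [hqF]
      simp only [eval_pow, eval_add, eval_mul, eval_X, eval_C, mul_div_cancel₀ _ hd,
        neg_add_cancel, zero_pow (Nat.succ_ne_zero _)]
    rw [eval_mul, eval_mul, this, mul_zero, zero_mul]
  have hz : (pF * qF * (pF - qF)).eval (-1) = 0 := by
    have : pF.eval (-1) = 0 := by
      rw [hpF]
      simp only [eval_mul, eval_pow, eval_add, eval_X, eval_C, neg_add_cancel,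
        zero_pow (Nat.succ_ne_zero _), zero_mul]
    rw [eval_mul, eval_mul, this, zero_mul, zero_mul]
  have hw : (pF * qF * (pF - qF)).eval (2 * (k : ℂ) + 4) = 0 := by
    have : pF.eval (2 * (k : ℂ) + 4) = 0 := by
      rw [hpF]
      simp only [eval_mul, eval_pow, eval_sub, eval_X, eval_C, sub_self,
        zero_pow (Nat.succ_ne_zero _), mul_zero]
    rw [eval_mul, eval_mul, this, zero_mul, zero_mul]
  have hyz : (-(2 * (k : ℂ) + 4) / (2 * (k : ℂ) + 5)) ≠ -1 := fun h => by
    have h' : (-(2 * (k : ℤ) + 4) : ℤ) = -1 * (2 * k + 5) := by exact_mod_cast (div_eq_iff hd).mp h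
    omega
  have hyw : (-(2 * (k : ℂ) + 4) / (2 * (k : ℂ) + 5)) ≠ 2 * (k : ℂ) + 4 := fun h => by
    have h' : (-(2 * (k : ℤ) + 4) : ℤ) = (2 * k + 4) * (2 * k + 5) := by
      exact_mod_cast (div_eq_iff hd).mp h
    nlinarith
  have hzw : (-1 : ℂ) ≠ 2 * (k : ℂ) + 4 := fun h => by
    have h' : (-1 : ℤ) = 2 * k + 4 := by exact_mod_cast h
    omega
  have hcr : (-(2 * (k : ℂ) + 4) / (2 * (k : ℂ) + 5) - (-1)) / (2 * (k : ℂ) + 4 - (-1)) =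
      ((1 : ℕ) : ℂ) / (((2 * k + 5) ^ 2 : ℕ) : ℂ) := by
    rw [show (2 * (k : ℂ) + 4 - (-1)) = 2 * (k : ℂ) + 5 by ring]
    push_cast
    field_simp
    ring
  obtain ⟨P, Q, x', y', z', w', h1, h2, h3, h4, h5, h6, h7, h8⟩ :=
    BelyiSqueeze.exists_crossRatio_chart hcop hmax hdrop hcard hyz hyw hzw hy hz hw
  exact ⟨P, Q, x', y', z', w', h1, h2, h3, h4, h5, h6, h7, by rw [h8, hcr]⟩

/-- Refutes `BelyiSqueeze.DegBelyiLower`: for every `k` the abc triple `(1, d² − 1, d²)`,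
`d = 2k + 5`, carries a Belyi witness of degree `d` (`BelyiSqueeze.square_witness`: the Belyi map
`φ = (−1)^m d^d t^{m+1}(t−1)^m/(d²t−1)^m`, `d = 2m+1`, has special points `0, 1, ∞, 1/d², 1/d`),
while the crux at `ε = 1/2` demands `d² ≤ C · d^{3/2}`; take `k > C²`. [folklore] -/
theorem BelyiSqueezeDegBelyiLower_refuted :
    ¬ Summit.ABC.ABC.Theses.BelyiSqueeze.DegBelyiLower := by
  intro H
  obtain ⟨C, hC, H⟩ := H (1 / 2) (by norm_num)
  obtain ⟨k, hk⟩ := exists_nat_gt (C ^ 2)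
  have h25 : 5 ^ 2 ≤ (2 * k + 5) ^ 2 := Nat.pow_le_pow_left (by omega) 2
  have htri : Literature.NumberTheory.DiophantineGeometry.IsABCTriple 1 ((2 * k + 5) ^ 2 - 1)
      ((2 * k + 5) ^ 2) :=
    ⟨Nat.one_pos, by omega, by omega, Nat.coprime_one_left _⟩
  obtain ⟨P, Q, x, y, z, w, h1, h2, h3, h4, h5, h6, h7, h8⟩ := BelyiSqueeze.square_witness k
  have hle := H 1 ((2 * k + 5) ^ 2 - 1) ((2 * k + 5) ^ 2) htri (2 * k + 5)
    ⟨P, Q, x, y, z, w, h1, h2, h3, h4, h5, h6, h7, h8⟩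
  push_cast at hle
  have hDpos : (0 : ℝ) < 2 * (k : ℝ) + 5 := by positivity
  set D : ℝ := 2 * (k : ℝ) + 5 with hD
  set s : ℝ := D ^ ((1 : ℝ) / 2) with hs
  have hspos : 0 < s := Real.rpow_pos_of_pos hDpos _
  have hss : s * s = D := by rw [hs, ← Real.rpow_add hDpos]; norm_num
  rw [Real.rpow_add hDpos, Real.rpow_one] at hle
  have hsC : s ≤ C := by
    have hDs : 0 < D * s := mul_pos hDpos hspos
    have h' : s * (D * s) ≤ C * (D * s) := by nlinarith [hss, hle]
    exact le_of_mul_le_mul_right h' hDs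
  have hDC : D ≤ C ^ 2 := by rw [← hss]; nlinarith [hsC, hspos.le, hC.le]
  have hkD : (k : ℝ) < D := by rw [hD]; linarith
  linarith

end Summit.ABC.ABC.Theorems
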